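import Mathlib
import Summits.CriticalPhenomena.PercolationContinuityZ3.Theorems.PercNearOneGluingNearOneGluingHubPiece
import Literature.Probability.Percolation.RSW
import HarnessLib

/-!
# The ordering bound (summation of the hub piece lemma)

Stub `stub_orderingBound` of line `SketchR2I5` (Cycle 3) for the crux `PercNearOneGluing.NearOneGluing`
(item stmt-CriticalPhenomena-4574 = Kozma–Nitzan Conjecture 3, typed over all finite weighted graphs).

Setting: one finite weighted graph — vertices `Fin n`, weights `w`, `μ = prodBernoulli w` on bond
configurations `ω : Set (Sym2 (Fin n))`; relay set `A ∌ o`, source `o`, target `b`, and an injective rank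
function `r : Fin n → ℕ`.  For a vertex `v` put `U v := insert o {x | r v < r x}` (the vertices ranked
after `v`, plus `o`), and for a finite vertex set `K`
* `piece v K := {∃ a ∈ A, o ↔ a inside insert v (U v)} ∩ {𝒦_{U v} = K}`, where
  `{𝒦_U = K} := {ω | ∀ x, x ∈ K ↔ o ↔ x inside U}`;
* `good v K :↔ o ∈ K ∧ K ⊆ U v ∧ Disjoint K A`.

**Claim** (`stub_orderingBound`):
`μ(o ↮ b, o ↔ A) ≤ Σ_v Σ_{K good} μ(piece v K) · μ{Φ_{K, U v} ω ∉ openConn v b}`,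
`Φ_{K,U} ω = (ω ∪ pairs K) ∖ pairs(K, U ∖ K)`.

Proof.
1. COVER (`orderingBound_cover`): if `o ↔ a`, `a ∈ A`, let `v` be a vertex of MAXIMAL rank with
   `o ↔ A inside insert v (U v)` (the vertex of minimal rank qualifies, since then `insert v (U v)` is
   everything), and let `K := 𝒦_{U v}` be the open cluster of `o` inside `U v`.  Then `o ∈ K ⊆ U v`, and `K`
   is relay-free: a relay `a' ∈ K` has `r v < r a'`, so the vertex `x` of minimal rank above `v` exists and
   `U v ⊆ insert x (U x)`, whence `o ↔ a'` inside `insert x (U x)` with `r x > r v` — contradicting the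
   maximality of `v`.  So `ω ∈ piece v K` with `K` good.
2. UNION BOUND (`orderingBound_measureReal_le_sum_sum`): `μ(bad) ≤ Σ_v Σ_{K good} μ(piece v K ∩ {o ↮ b})`.
3. PIECES (`orderingBound_term`): for `v ≠ o` one has `v ∉ U v` and the landed hub piece lemma
   `stub_hubPiece` is exactly the per-term bound; for `v = o`, `insert v (U v) = U v` and a good `K` makes
   the piece empty (the relay reached inside `U v` would lie in `K`).
-/

namespace Summit.CriticalPhenomena.PercolationContinuityZ3.Theorems

open MeasureTheory Set Literature.Probability.LatticeModels Literature.Probability.Percolation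
open scoped Classical BigOperators

section OrderingBound

variable {n : ℕ}

/-- **Double union bound.**  If every point of `S` lies in some `P i k` with `k ∈ s i`, and
`μ(P i k) ≤ B i k` termwise, then `μ S ≤ Σ_i Σ_{k ∈ s i} B i k`. -/
theorem orderingBound_measureReal_le_sum_sum {α ι κ : Type*} [MeasurableSpace α] (μ : Measure α)
    [IsFiniteMeasure μ] [Fintype ι] (s : ι → Finset κ) (S : Set α) (P : ι → κ → Set α)
    (B : ι → κ → ℝ) (hcover : ∀ ω ∈ S, ∃ i, ∃ k ∈ s i, ω ∈ P i k)
    (hterm : ∀ i, ∀ k ∈ s i, μ.real (P i k) ≤ B i k) :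
    μ.real S ≤ ∑ i, ∑ k ∈ s i, B i k := by
  calc μ.real S ≤ μ.real (⋃ i, ⋃ k ∈ s i, P i k) := by
        refine measureReal_mono ?_ (measure_ne_top _ _)
        intro ω hω
        obtain ⟨i, k, hk, hωP⟩ := hcover ω hω
        exact Set.mem_iUnion.2 ⟨i, Set.mem_iUnion₂.2 ⟨k, hk, hωP⟩⟩
    _ ≤ ∑ i, μ.real (⋃ k ∈ s i, P i k) := measureReal_iUnion_fintype_le _
    _ ≤ ∑ i, ∑ k ∈ s i, μ.real (P i k) :=
        Finset.sum_le_sum fun i _ => measureReal_biUnion_finset_le _ _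
    _ ≤ ∑ i, ∑ k ∈ s i, B i k :=
        Finset.sum_le_sum fun i _ => Finset.sum_le_sum fun k hk => hterm i k hk

/-- **Per-term bound.**  For `o ∈ U`, a relay-free `K` with `o ∈ K ⊆ U`, and a vertex `v` with `v ∉ U` or
`v = o`: `μ(Piv ∩ {𝒦_U = K} ∩ {o ↮ b}) ≤ μ(Piv ∩ {𝒦_U = K}) · μ{Φ_K ω ∉ openConn v b}`,
`Piv := {∃ a ∈ A, o ↔ a inside insert v U}`.  For `v ∉ U` this is the hub piece lemma `stub_hubPiece`;
for `v = o` the event `Piv ∩ {𝒦_U = K}` is empty (`insert v U = U`, so the relay reached inside `U`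
belongs to the relay-free cluster `K`). -/
theorem orderingBound_term (w : Sym2 (Fin n) → unitInterval) (A U K : Finset (Fin n)) (o b v : Fin n)
    (hoU : o ∈ U) (hv : v ∉ U ∨ v = o) (ho : o ∈ K) (hKU : K ⊆ U) (hKA : Disjoint K A) :
    (prodBernoulli w).real
        ({ω | ∃ a ∈ A, ω ∈ openConnIn (↑(insert v U) : Set (Fin n)) o a} ∩
          {ω | ∀ x : Fin n, x ∈ K ↔ ω ∈ openConnIn (↑U : Set (Fin n)) o x} ∩ (openConn o b)ᶜ) ≤
      (prodBernoulli w).real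
          ({ω | ∃ a ∈ A, ω ∈ openConnIn (↑(insert v U) : Set (Fin n)) o a} ∩
            {ω | ∀ x : Fin n, x ∈ K ↔ ω ∈ openConnIn (↑U : Set (Fin n)) o x}) *
        (prodBernoulli w).real
          {ω | (ω ∪ {e | ∃ x ∈ K, ∃ y ∈ K, e = s(x, y)}) \ {e | ∃ x ∈ K, ∃ y ∈ U \ K, e = s(x, y)} ∉
            openConn v b} := by
  rcases hv with hv | hv
  · exact stub_hubPiece n w A U K o b v ho hKU hv hKA
  · have hvU : v ∈ U := hv ▸ hoU
    have hsub : (↑(insert v U) : Set (Fin n)) ⊆ (↑U : Set (Fin n)) := by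
      rw [Finset.insert_eq_of_mem hvU]
    have hempty : ({ω | ∃ a ∈ A, ω ∈ openConnIn (↑(insert v U) : Set (Fin n)) o a} ∩
        {ω | ∀ x : Fin n, x ∈ K ↔ ω ∈ openConnIn (↑U : Set (Fin n)) o x} ∩ (openConn o b)ᶜ :
          Set (Set (Sym2 (Fin n)))) ⊆ ∅ := by
      rintro ω ⟨⟨⟨a, haA, hoa⟩, hE⟩, -⟩
      exact Finset.disjoint_left.1 hKA ((hE a).2 (openConnIn_mono hsub o a hoa)) haA
    calc (prodBernoulli w).real
          ({ω | ∃ a ∈ A, ω ∈ openConnIn (↑(insert v U) : Set (Fin n)) o a} ∩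
            {ω | ∀ x : Fin n, x ∈ K ↔ ω ∈ openConnIn (↑U : Set (Fin n)) o x} ∩ (openConn o b)ᶜ)
          ≤ (prodBernoulli w).real (∅ : Set (Set (Sym2 (Fin n)))) :=
            measureReal_mono hempty (measure_ne_top _ _)
      _ = 0 := measureReal_empty
      _ ≤ _ := mul_nonneg measureReal_nonneg measureReal_nonneg

/-- **Cover.**  If `o ↔ a` for some relay `a ∈ A` (`o ∉ A`, `r` injective), then for the vertex `v` of
maximal rank with `o ↔ A` inside `insert v (U v)`, `U v := insert o {x | r v < r x}`, and the open cluster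
`K` of `o` inside `U v`: `o ∈ K ⊆ U v`, `K` is relay-free, and `ω ∈ piece v K`. -/
theorem orderingBound_cover {A : Finset (Fin n)} {o : Fin n} {r : Fin n → ℕ}
    (hr : Function.Injective r) (hoA : o ∉ A) {ω : Set (Sym2 (Fin n))}
    (h : ∃ a ∈ A, ω ∈ openConn o a) :
    ∃ v : Fin n, ∃ K ∈ (Finset.univ : Finset (Finset (Fin n))).filter
        (fun K => o ∈ K ∧ K ⊆ insert o (Finset.univ.filter (fun x => r v < r x)) ∧ Disjoint K A),
      ω ∈ ({ω | ∃ a ∈ A, ω ∈ openConnIn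
            (↑(insert v (insert o (Finset.univ.filter (fun x => r v < r x)))) : Set (Fin n)) o a} ∩
          {ω | ∀ x : Fin n, x ∈ K ↔
            ω ∈ openConnIn (↑(insert o (Finset.univ.filter (fun x => r v < r x))) : Set (Fin n)) o x} :
          Set (Set (Sym2 (Fin n)))) := by
  obtain ⟨a, haA, hoa⟩ := h
  -- the "good" vertices: `o ↔ A` inside `insert v (U v)`
  obtain ⟨Good, hGood⟩ : ∃ Good : Finset (Fin n), ∀ v : Fin n, v ∈ Good ↔ ∃ a ∈ A,
      ω ∈ openConnIn (↑(insert v (insert o (Finset.univ.filter (fun x => r v < r x)))) : Set (Fin n))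
        o a :=
    ⟨Finset.univ.filter (fun v => ∃ a ∈ A, ω ∈ openConnIn
        (↑(insert v (insert o (Finset.univ.filter (fun x => r v < r x)))) : Set (Fin n)) o a),
      fun v => by simp only [Finset.mem_filter, Finset.mem_univ, true_and]⟩
  -- the vertex of minimal rank is good
  obtain ⟨v₀, -, hv₀⟩ := Finset.exists_min_image Finset.univ r ⟨o, Finset.mem_univ o⟩
  have hGoodne : Good.Nonempty := by
    refine ⟨v₀, (hGood v₀).2 ⟨a, haA, ?_⟩⟩
    have hsub : (Set.univ : Set (Fin n)) ⊆
        (↑(insert v₀ (insert o (Finset.univ.filter (fun x => r v₀ < r x)))) : Set (Fin n)) := by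
      intro x _
      rw [Finset.mem_coe, Finset.mem_insert, Finset.mem_insert, Finset.mem_filter]
      by_cases hx : x = v₀
      · exact Or.inl hx
      · exact Or.inr (Or.inr ⟨Finset.mem_univ x,
          lt_of_le_of_ne (hv₀ x (Finset.mem_univ x)) (fun h' => hx (hr h').symm)⟩)
    exact DCT16.mem_openConnIn_of_pathIn ((DCT16.pathIn_univ_of_reachable hoa).mono hsub)
  -- a good vertex of maximal rank
  obtain ⟨v, hvG, hvmax⟩ := Finset.exists_max_image Good r hGoodne
  obtain ⟨a', ha'A, hoa'⟩ := (hGood v).1 hvG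
  refine ⟨v, Finset.univ.filter (fun x => ω ∈ openConnIn
      (↑(insert o (Finset.univ.filter (fun x => r v < r x))) : Set (Fin n)) o x), ?_, ?_⟩
  · refine Finset.mem_filter.2 ⟨Finset.mem_univ _, ?_, ?_, ?_⟩
    · -- `o ∈ K`
      exact Finset.mem_filter.2 ⟨Finset.mem_univ o, DCT16.mem_openConnIn_of_pathIn
        (PathIn.refl (Finset.mem_coe.2 (Finset.mem_insert_self o _)))⟩
    · -- `K ⊆ U v`
      intro x hx
      exact Finset.mem_coe.1 (DCT16.pathIn_of_mem_openConnIn (Finset.mem_filter.1 hx).2).right_mem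
    · -- `K` is relay-free, by maximality of `v`
      rw [Finset.disjoint_left]
      intro a₁ ha₁K ha₁A
      have hoa₁ : ω ∈ openConnIn
          (↑(insert o (Finset.univ.filter (fun x => r v < r x))) : Set (Fin n)) o a₁ :=
        (Finset.mem_filter.1 ha₁K).2
      have ha₁U : a₁ ∈ insert o (Finset.univ.filter (fun x => r v < r x)) :=
        Finset.mem_coe.1 (DCT16.pathIn_of_mem_openConnIn hoa₁).right_mem
      have hra₁ : r v < r a₁ := by
        rcases Finset.mem_insert.1 ha₁U with h₁ | h₁
        · exact absurd (h₁ ▸ ha₁A) hoA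
        · exact (Finset.mem_filter.1 h₁).2
      -- the vertex of minimal rank above `v`
      obtain ⟨x, hx, hxmin⟩ := Finset.exists_min_image (Finset.univ.filter (fun x => r v < r x)) r
        ⟨a₁, Finset.mem_filter.2 ⟨Finset.mem_univ _, hra₁⟩⟩
      have hrx : r v < r x := (Finset.mem_filter.1 hx).2
      have hsub : (↑(insert o (Finset.univ.filter (fun y => r v < r y))) : Set (Fin n)) ⊆
          (↑(insert x (insert o (Finset.univ.filter (fun y => r x < r y)))) : Set (Fin n)) := by
        intro y hy
        rw [Finset.mem_coe, Finset.mem_insert, Finset.mem_insert, Finset.mem_filter]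
        rcases Finset.mem_insert.1 (Finset.mem_coe.1 hy) with h₁ | h₁
        · exact Or.inr (Or.inl h₁)
        · by_cases hyx : y = x
          · exact Or.inl hyx
          · exact Or.inr (Or.inr ⟨Finset.mem_univ y,
              lt_of_le_of_ne (hxmin y h₁) (fun h' => hyx (hr h').symm)⟩)
      have hxG : x ∈ Good := (hGood x).2 ⟨a₁, ha₁A, openConnIn_mono hsub o a₁ hoa₁⟩
      exact absurd (hvmax x hxG) (not_le.2 hrx)
  · refine ⟨⟨a', ha'A, hoa'⟩, fun x => ?_⟩
    simp only [Finset.mem_filter, Finset.mem_univ, true_and]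

/-- **The ORDERING BOUND** (stub `stub_orderingBound` of line `SketchR2I5`; a theorem, by summation of the hub
piece lemma `stub_hubPiece`).  For every injective rank function `r` on the vertices and `o ∉ A`: with
`U v := {x | r v < r x} ∪ {o}` (the vertices ranked after `v`, plus `o`), the pieces
`Piv_v := {o ↔ A inside U v ∪ {v}} ∖ {o ↔ A inside U v}` cover `{o ↔ A}` (take the `v` of maximal rank with
`o ↔ A inside U v ∪ {v}`), and on `Piv_v` the cluster `𝒦_{U v}` of `o` inside `U v` is relay-free; summing
`stub_hubPiece` over `v` and over the relay-free `K` with `o ∈ K ⊆ U v`: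
`μ(o ↔ A, o ↮ b) ≤ Σ_v Σ_K μ(Piv_v ∩ {𝒦_{U v} = K}) · μ{Φ_{K,U v} ω ∉ openConn v b}`,
`Φ_{K,U} ω = (ω ∪ pairs K) ∖ pairs(K, U ∖ K)`. -/
theorem stub_orderingBound :
    ∀ (n : ℕ) (w : Sym2 (Fin n) → unitInterval) (A : Finset (Fin n)) (o b : Fin n) (r : Fin n → ℕ),
      Function.Injective r → o ∉ A →
      (prodBernoulli w).real {ω | ω ∉ openConn o b ∧ ∃ a ∈ A, ω ∈ openConn o a} ≤
        ∑ v : Fin n, ∑ K ∈ (Finset.univ : Finset (Finset (Fin n))).filter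
            (fun K => o ∈ K ∧ K ⊆ insert o (Finset.univ.filter (fun x => r v < r x)) ∧ Disjoint K A),
          (prodBernoulli w).real
              ({ω | ∃ a ∈ A, ω ∈ openConnIn
                  (↑(insert v (insert o (Finset.univ.filter (fun x => r v < r x)))) : Set (Fin n)) o a} ∩
                {ω | ∀ x : Fin n, x ∈ K ↔
                  ω ∈ openConnIn (↑(insert o (Finset.univ.filter (fun x => r v < r x))) : Set (Fin n)) o x}) *
            (prodBernoulli w).real
              {ω | (ω ∪ {e | ∃ x ∈ K, ∃ y ∈ K, e = s(x, y)}) \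
                  {e | ∃ x ∈ K, ∃ y ∈ insert o (Finset.univ.filter (fun x => r v < r x)) \ K, e = s(x, y)} ∉
                openConn v b} := by
  intro n w A o b r hr hoA
  refine orderingBound_measureReal_le_sum_sum (prodBernoulli w) _ _
    (fun v K => {ω | ∃ a ∈ A, ω ∈ openConnIn
        (↑(insert v (insert o (Finset.univ.filter (fun x => r v < r x)))) : Set (Fin n)) o a} ∩
      {ω | ∀ x : Fin n, x ∈ K ↔
        ω ∈ openConnIn (↑(insert o (Finset.univ.filter (fun x => r v < r x))) : Set (Fin n)) o x} ∩
      (openConn o b)ᶜ) _ ?_ ?_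
  · -- cover
    rintro ω ⟨hob, hoa⟩
    obtain ⟨v, K, hK, hω⟩ := orderingBound_cover hr hoA hoa
    exact ⟨v, K, hK, hω, hob⟩
  · -- termwise bound
    intro v K hK
    obtain ⟨-, ho, hKU, hKA⟩ := Finset.mem_filter.1 hK
    have hoU : o ∈ insert o (Finset.univ.filter (fun x => r v < r x)) := Finset.mem_insert_self _ _
    have hv : v ∉ insert o (Finset.univ.filter (fun x => r v < r x)) ∨ v = o := by
      by_cases hvo : v = o
      · exact Or.inr hvo
      · refine Or.inl fun h => ?_
        rcases Finset.mem_insert.1 h with h | h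
        · exact hvo h
        · exact lt_irrefl _ (Finset.mem_filter.1 h).2
    exact orderingBound_term w A _ K o b v hoU hv ho hKU hKA

end OrderingBound

end Summit.CriticalPhenomena.PercolationContinuityZ3.Theorems
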